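import Literature.AlgebraicGeometry.Resolution.CurveStepChartData
import Literature.AlgebraicGeometry.Resolution.AdaptedSystems
import Literature.AlgebraicGeometry.Resolution.TauOneAdaptedCoordinates
import Literature.AlgebraicGeometry.Resolution.PointStepTrichotomy
import Literature.AlgebraicGeometry.Resolution.Isolation
import HarnessLib

/-!
# Adapted regular systems at a `τ = 1` point: the `μ`-initial forms are multiples of `Y^μ`, hence `δ > 1`

OURS (res-inputs-p-8b g2; brick A-ii of PHASE A of the T1 line, memo `plan/inputs/PHASE-A-MEMO-p8b-v0.md` 9496d3247595a800).
For a regular system of parameters `c = (y, u₁, u₂)` of a regular local ring with Hironaka `τ(J, μ) = 1` that is ADAPTED at the indices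
`1, 2` (`IsAdapted`, i.e. `T_x = k·Y`), every `μ`-initial form of `J` is `a · Y^μ` (Cossart–Piltant p. 11 «`in_μ(J) = k·Y^μ`»; the triple
version of `initialForms_pair_adapted_of_isAdapted`), and consequently `L < δs` (`AdaptedSystems.lt_deltaS_of_forall_initialForms`, CJS (12.1))
— the `hδ` input of the ring step laws `exists_prepared_label_pointStep` / `…chartTwoStep` / `…curveStep`. Converse direction
(forms ⇒ `IsAdapted`): `isAdapted_of_forall_initialForms_eq_C_mul_X_pow` (res-inputs-p-6); with it, brick A-i: at a `τ = 1` point of a scheme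
there is a regular system of parameters adapted at the indices `1, 2` (index `0` = the directrix; a relabelling of
`exists_rsop_forall_ne_isAdapted_of_stalkTau_eq_one` by the transposition `(0 j₀)`). No new definitions.
F-71 / resolution in dim ≥ 4 or char p NOT proved here.
-/

noncomputable section

open IsLocalRing MvPolynomial

namespace Literature.AlgebraicGeometry.Resolution

universe u

variable {R : Type u} [CommRing R] [IsRegularLocalRing R]

/-- **`τ = 1` and `(y, u₁, u₂)` adapted at `1, 2` ⇒ every `μ`-initial form of `J` is `a · Y^μ`.** The directrix is spanned by one linear form
`ℓ` (`τ = 1`) and `ℓ(e₁) = ℓ(e₂) = 0` by adaptedness, so `ℓ = ℓ(e₀)·Y₀`. [cite: CossartPiltant2008, Prop. 4.4 (proof, p. 11)] -/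
theorem forall_initialForms_eq_C_mul_X_pow_of_isAdapted (c : Fin 3 → R) {J : Ideal R} {μ : ℕ} (hτ : hironakaTauAt c J μ = 1)
    (had : ∀ i, i ≠ 0 → IsAdapted c J μ i) :
    ∀ G ∈ initialForms c J μ, ∃ a : ResidueField R, G = C a * X (0 : Fin 3) ^ μ := by
  classical
  obtain ⟨ℓ, -, hℓd, hℓ⟩ := exists_forall_initialForms_eq_of_hironakaTauAt_eq_one c hτ
  have hℓi : ∀ i, i ≠ 0 → ℓ (Pi.single i 1) = 0 := fun i hi => (had i hi).apply_single_eq_zero hℓd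
  have hlin : linearFormPoly (ResidueField R) ℓ = C (ℓ (Pi.single 0 1)) * X 0 := by
    rw [linearFormPoly, Fin.sum_univ_three, hℓi 1 (by decide), hℓi 2 (by decide)]
    simp
  intro G hG
  obtain ⟨b, hb⟩ := hℓ G hG
  refine ⟨b * ℓ (Pi.single 0 1) ^ μ, ?_⟩
  rw [hb, hlin, mul_pow, ← C_pow, ← mul_assoc, ← C_mul]

/-- **Adapted at a `τ = 1` point ⇒ `L < δs`** (with Newton points present and `J ⊆ 𝔪^μ`): the `hδ` input of the ring step laws.
[cite: CossartJannsenSaito2020, (12.1)] [cite: CossartPiltant2008, §4 p. 12] -/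
theorem factorial_lt_deltaS_of_isAdapted (c : Fin 3 → R) (hgen : Ideal.span {c 0, c 1, c 2} = maximalIdeal R)
    (hdim : ringKrullDim R = 3) {J : Ideal R} {μ : ℕ} (hJμ : J ≤ maximalIdeal R ^ μ) (hne : (pts c J μ).Nonempty)
    (hτ : hironakaTauAt c J μ = 1) (had : ∀ i, i ≠ 0 → IsAdapted c J μ i) :
    μ.factorial < deltaS c J μ :=
  lt_deltaS_of_forall_initialForms c hgen hdim hJμ hne (forall_initialForms_eq_C_mul_X_pow_of_isAdapted c hτ had)

/-- The same for an arbitrary directrix index `j₀`: `τ = 1` and adapted at every `i ≠ j₀` ⇒ every `μ`-initial form is `a · Y_{j₀}^μ`.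
[cite: CossartPiltant2008, Prop. 4.4 (proof, p. 11)] -/
theorem forall_initialForms_eq_C_mul_X_pow_of_isAdapted_ne (c : Fin 3 → R) {J : Ideal R} {μ : ℕ} (hτ : hironakaTauAt c J μ = 1)
    (j₀ : Fin 3) (had : ∀ i, i ≠ j₀ → IsAdapted c J μ i) :
    ∀ G ∈ initialForms c J μ, ∃ a : ResidueField R, G = C a * X j₀ ^ μ := by
  classical
  obtain ⟨ℓ, -, hℓd, hℓ⟩ := exists_forall_initialForms_eq_of_hironakaTauAt_eq_one c hτ
  have hℓi : ∀ i, i ≠ j₀ → ℓ (Pi.single i 1) = 0 := fun i hi => (had i hi).apply_single_eq_zero hℓd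
  have hlin : linearFormPoly (ResidueField R) ℓ = C (ℓ (Pi.single j₀ 1)) * X j₀ := by
    rw [linearFormPoly, Finset.sum_eq_single j₀ (fun i _ hi => by rw [hℓi i hi, C_0, zero_mul]) (fun h => absurd (Finset.mem_univ _) h)]
  intro G hG
  obtain ⟨b, hb⟩ := hℓ G hG
  refine ⟨b * ℓ (Pi.single j₀ 1) ^ μ, ?_⟩
  rw [hb, hlin, mul_pow, ← C_pow, ← mul_assoc, ← C_mul]

/-! ## Brick A-i: an adapted regular system with the directrix at index `0` -/

variable {X : AlgebraicGeometry.Scheme.{u}}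

open AlgebraicGeometry AlgebraicGeometry.Scheme.IdealSheafData in
/-- **At a point with regular three-dimensional local ring and `τ_x(J, μ) = 1` there is a regular system of parameters `c = (y, u₁, u₂)` ADAPTED
at the indices `1, 2`** (index `0` carries the directrix `T_x = k·Y`; Cossart–Piltant p. 9 «we may choose (y₁, y₂, y₃) such that T_x = k(x)·Y₃»):
`exists_rsop_forall_ne_isAdapted_of_stalkTau_eq_one` relabelled by the transposition `(0 j₀)`, using the forms characterisation and res-inputs-p-6's
`isAdapted_of_forall_initialForms_eq_C_mul_X_pow`. [cite: CossartPiltant2008, Lemma 4.3 (5) (proof)] -/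
theorem exists_rsop_forall_ne_zero_isAdapted_of_stalkTau_eq_one (J : X.IdealSheafData) (x : X)
    [IsRegularLocalRing (X.presheaf.stalk x)] (hd : (maximalIdeal (X.presheaf.stalk x)).spanFinrank = 3) {μ : ℕ}
    (hτ : stalkTau J x μ = 1) :
    ∃ c : Fin 3 → X.presheaf.stalk x, Ideal.span (Set.range c) = maximalIdeal _ ∧
      ∀ i, i ≠ 0 → IsAdapted c (stalkIdeal J x) μ i := by
  classical
  obtain ⟨c, j₀, hc, had⟩ := exists_rsop_forall_ne_isAdapted_of_stalkTau_eq_one J x hd hτ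
  let σ : Equiv.Perm (Fin 3) := Equiv.swap 0 j₀
  have hrange : Set.range (c ∘ σ) = Set.range c := σ.surjective.range_comp c
  refine ⟨c ∘ σ, by rw [hrange, hc], fun i hi => ?_⟩
  have hτc : hironakaTauAt c (stalkIdeal J x) μ = 1 := by rw [← stalkTau_eq J x μ hd c hc]; exact hτ
  have hforms := forall_initialForms_eq_C_mul_X_pow_of_isAdapted_ne c hτc j₀ had
  refine isAdapted_of_forall_initialForms_eq_C_mul_X_pow (c ∘ σ) (stalkIdeal J x) μ 0 (fun G hG => ?_) hi
  have hmem : rename σ G ∈ initialForms c (stalkIdeal J x) μ :=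
    initialForms_comp_map_rename_le c σ (stalkIdeal J x) μ ⟨G, hG, rfl⟩
  obtain ⟨a, ha⟩ := hforms _ hmem
  refine ⟨a, rename_injective (σ : Fin 3 → Fin 3) σ.injective ?_⟩
  rw [ha, map_mul, map_pow, rename_C, rename_X]
  simp [σ]

/-! ## At an ISOLATED point of `{ord ≥ μ}` every label has Newton points and `α < 1` (the `hne`/`hα` inputs of the step laws) -/

/-- **Isolation ⇒ `J ⊄ (y, u₁)^μ` for every regular system `(y, u₁, u₂)`**: the prime `𝔮 = (y, u₁) ≠ 𝔪` would carry `J R_𝔮 ⊆ 𝔮^μ R_𝔮`.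
(The conversion used inside `exists_vPrepared_of_isolated`, exported.) [cite: CossartJannsenSaito2020, Thm. 13.7 (isolation)] -/
theorem not_le_span_pair_pow_of_isolated (c : Fin 3 → R) (hgen : Ideal.span {c 0, c 1, c 2} = maximalIdeal R)
    (hdim : ringKrullDim R = 3) {J : Ideal R} {μ : ℕ}
    (hisol : ∀ (𝔮 : Ideal R) [𝔮.IsPrime], 𝔮 ≠ maximalIdeal R →
      ¬ J.map (algebraMap R (Localization.AtPrime 𝔮)) ≤ maximalIdeal (Localization.AtPrime 𝔮) ^ μ) :
    ¬ J ≤ Ideal.span {c 0, c 1} ^ μ := by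
  classical
  intro hle
  have hfr : (maximalIdeal R).spanFinrank = 3 := by
    have h := IsRegularLocalRing.spanFinrank_maximalIdeal (R := R)
    rw [hdim] at h
    exact_mod_cast h
  have hrange : Set.range c = {c 0, c 1, c 2} := by
    ext s
    simp only [Set.mem_range, Set.mem_insert_iff, Set.mem_singleton_iff]
    constructor
    · rintro ⟨i, rfl⟩
      fin_cases i
      · exact Or.inl rfl
      · exact Or.inr (Or.inl rfl)
      · exact Or.inr (Or.inr rfl)
    · rintro (h | h | h) <;> exact ⟨_, h.symm⟩
  have hcr : Ideal.span (Set.range c) = maximalIdeal R := by rw [hrange, hgen]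
  set 𝔮 : Ideal R := Ideal.span {c 0, c 1} with h𝔮
  have h𝔮prime : 𝔮.IsPrime := by
    have h := isPrime_span_image hfr c hcr ({0, 1} : Finset (Fin 3))
    rwa [Finset.coe_pair, Set.image_pair] at h
  have h𝔮ne : 𝔮 ≠ maximalIdeal R := by
    intro heq
    have h := not_mem_span_image_of_not_mem hfr c hcr (S := {0, 1}) (i := 2) (by simp)
    rw [Set.image_pair] at h
    apply h
    change c 2 ∈ 𝔮
    rw [heq, ← hgen]
    exact Ideal.subset_span (by simp)
  haveI := h𝔮prime
  refine hisol 𝔮 h𝔮ne ?_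
  rw [← Localization.AtPrime.map_eq_maximalIdeal, ← Ideal.map_pow]
  exact Ideal.map_mono hle

/-- **At an isolated point of `{ord ≥ μ}` every regular system `(y, u₁, u₂)` has Newton points and `αs < L`** (`α < 1`: the curve `V(y, u₁)`
is not permissible) — the `hne`/`hα` inputs of `exists_prepared_label_chartTwoStep` / `exists_prepared_label_nonRationalStep` at a POINT
step of the `τ = 1` line. [cite: CossartJannsenSaito2020, Thm. 13.7] [cite: CossartPiltant2008, Prop. 4.4 (proof, p. 12)] -/
theorem pts_nonempty_and_alphaS_lt_of_isolated (c : Fin 3 → R) (hgen : Ideal.span {c 0, c 1, c 2} = maximalIdeal R)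
    (hdim : ringKrullDim R = 3) {J : Ideal R} {μ : ℕ}
    (hisol : ∀ (𝔮 : Ideal R) [𝔮.IsPrime], 𝔮 ≠ maximalIdeal R →
      ¬ J.map (algebraMap R (Localization.AtPrime 𝔮)) ≤ maximalIdeal (Localization.AtPrime 𝔮) ^ μ) :
    (pts c J μ).Nonempty ∧ alphaS c J μ < μ.factorial :=
  alphaS_lt_of_not_le_span_pair_pow c hgen hdim (not_le_span_pair_pow_of_isolated c hgen hdim hisol)

/-! ## Relabelling: adaptedness off the index `σ 0` transports to `c ∘ σ` off the index `0` -/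

open AlgebraicGeometry in
/-- **Permuting a label.** If every `μ`-initial form of `J` in the label `c` is `a · Y_{σ 0}^μ`, then the relabelled system `c ∘ σ` is adapted at
every index `i ≠ 0` (forms of `c ∘ σ` are renamings: `initialForms_comp_map_rename_le`; then `isAdapted_of_forall_initialForms_eq_C_mul_X_pow`).
Used with `σ = swap 1 2` to read the line centre / the chart data in the `u₂`-chart. [cite: CossartPiltant2008, Lemma 4.3 (5) (proof)] -/
theorem isAdapted_comp_perm_of_forall_initialForms {S : Type u} [CommRing S] [IsLocalRing S] (c : Fin 3 → S) (J : Ideal S) (μ : ℕ)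
    (σ : Equiv.Perm (Fin 3)) (h : ∀ G ∈ initialForms c J μ, ∃ a : ResidueField S, G = C a * MvPolynomial.X (σ 0) ^ μ) :
    ∀ i, i ≠ 0 → IsAdapted (c ∘ σ) J μ i := by
  classical
  intro i hi
  refine isAdapted_of_forall_initialForms_eq_C_mul_X_pow (c ∘ σ) J μ 0 (fun G hG => ?_) hi
  have hmem : rename σ G ∈ initialForms c J μ := initialForms_comp_map_rename_le c σ J μ ⟨G, hG, rfl⟩
  obtain ⟨a, ha⟩ := h _ hmem
  refine ⟨a, rename_injective (σ : Fin 3 → Fin 3) σ.injective ?_⟩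
  rw [ha, map_mul, map_pow, rename_C, rename_X]

/-- **Swapping `u₁ ↔ u₂` keeps adaptedness off the directrix index `0`** (`τ = 1`): the `u₂`-chart twin of every `u₁`-chart statement about
adapted labels (line centre, chart data) is obtained by applying it to `c ∘ swap 1 2`. [cite: CossartPiltant2008, Lemma 4.3 (5) (proof)] -/
theorem isAdapted_comp_swap_of_isAdapted (c : Fin 3 → R) {J : Ideal R} {μ : ℕ} (hτ : hironakaTauAt c J μ = 1)
    (had : ∀ i, i ≠ 0 → IsAdapted c J μ i) :
    ∀ i, i ≠ 0 → IsAdapted (c ∘ Equiv.swap (1 : Fin 3) 2) J μ i :=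
  isAdapted_comp_perm_of_forall_initialForms c J μ (Equiv.swap 1 2)
    (by
      have h0 : (Equiv.swap (1 : Fin 3) 2) 0 = 0 := by decide
      rw [h0]
      exact forall_initialForms_eq_C_mul_X_pow_of_isAdapted c hτ had)

end Literature.AlgebraicGeometry.Resolution

end
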